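import Literature.MathematicalPhysics.KineticTheory.HardSphereGibbsGNZSandwich
import Literature.Analysis.FunctionSpaces.PoissonPointProcessExistence
import Literature.Analysis.FunctionSpaces.PoissonSuperpositionProofs
import HarnessLib

/-!
# The hard-sphere local specification in Poisson form, general dimension

(topic MathematicalPhysics/KineticTheory; definitions `hardCoreSet`, `poissonLaw`, `glue`, `hsLocalSpec`,
`IsHsLocalGibbs` of the namespace `HardSphereDLR` — the general-dimension counterparts of the tree's
three-dimensional `HardSphere.hardCoreSet`, `HardSphere.poissonLaw`, `HardSphere.glue`,
`KineticTheory.hsLocalSpec`, `KineticTheory.IsHsLocalGibbs` — with their basic API; no named facts.)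

Configurations live on the phase space `ℝ^d × ℝ^d` (`𝔼 × 𝔼`, `𝔼 = EuclideanSpace ℝ d`, positions and
velocities); the window of a region `Λ ⊆ ℝ^d` is `window Λ = Λ × ℝ^d`
(`Literature.MathematicalPhysics.StatisticalMechanics.window`) and the hard core of diameter `σ` is
`Literature.Analysis.FluidPDE.IsHardCore σ` (`σ ≤ ‖p - q‖` for distinct particles).  For a one-particle
intensity `ν` on `𝔼 × 𝔼`, a region `Λ` and a boundary condition `η`, the finite-volume Gibbs
distribution `hsLocalSpec σ ν Λ η` samples a Poisson configuration of intensity `ν|_{Λ × ℝ^d}`, glues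
it to `η` outside `Λ`, and conditions on the hard core of the glued configuration (Georgii 2011,
Def. 1.23; Spohn 1991, (2.25)); `IsHsLocalGibbs σ ν μ` is the DLR property of a probability law `μ`.

## References

* H.-O. Georgii, *Gibbs Measures and Phase Transitions*, 2nd ed., de Gruyter 2011, Def. 1.23. [Georgii2011]
* H. Spohn, *Large Scale Dynamics of Interacting Particles*, Springer 1991, §2.2 (2.25). [Spohn1991]
* J. F. C. Kingman, *Poisson Processes*, Oxford 1993, §2.5. [Kingman1993]
* D. Ruelle, *Statistical Mechanics: Rigorous Results*, Benjamin 1969, §1.2.2 (2.12). [Ruelle1969]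
-/

noncomputable section

open MeasureTheory ProbabilityTheory Set Filter Topology Function
open scoped ENNReal NNReal

namespace Literature.MathematicalPhysics.KineticTheory

namespace HardSphereDLR

open Literature.Analysis.FluidPDE (IsHardCore isHardCore_empty HardCoreIn)
open Literature.Analysis.FunctionSpaces
open Literature.MathematicalPhysics.StatisticalMechanics (window mem_window measurableSet_window window_mono)

variable {d : Type*} [Fintype d]

local notation "𝔼" => EuclideanSpace ℝ d

/-! ### The hard-core event -/

/-- The set of hard-core configurations of diameter `σ` (`σ ≤ ‖p - q‖` for distinct particles).
[cite: Ruelle1969, §1.2.2 (2.12)] -/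
def hardCoreSet (σ : ℝ) : Set (PointConfig (𝔼 × 𝔼)) := {c | IsHardCore σ c}

/-- Unfolding lemma for `hardCoreSet`. [folklore] -/
@[simp] theorem mem_hardCoreSet {σ : ℝ} {c : PointConfig (𝔼 × 𝔼)} : c ∈ hardCoreSet σ ↔ IsHardCore σ c := Iff.rfl

/-- The hard-core constraint passes to sub-configurations. [folklore] -/
theorem isHardCore_of_subset {σ : ℝ} {c e : PointConfig (𝔼 × 𝔼)} (h : IsHardCore σ e)
    (hce : (c : Set (𝔼 × 𝔼)) ⊆ e) : IsHardCore σ c :=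
  fun x hx y hy hxy => h x (hce hx) y (hce hy) hxy

/-- The hard-core constraint passes to restrictions. [folklore] -/
theorem isHardCore_restrict {σ : ℝ} {c : PointConfig (𝔼 × 𝔼)} (h : IsHardCore σ c) (s : Set (𝔼 × 𝔼)) :
    IsHardCore σ (c.restrict s) :=
  isHardCore_of_subset h fun _ hx => hx.1

/-- The global hard core is the hard core "in the window `univ`". [folklore] -/
theorem hardCoreIn_univ_iff {σ : ℝ} {c : PointConfig (𝔼 × 𝔼)} : HardCoreIn σ univ c ↔ IsHardCore σ c :=
  ⟨fun h p hp q hq hpq => h p hp q hq hpq (Or.inl (mem_univ _)), fun h p hp q hq hpq _ => h p hp q hq hpq⟩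

/-- **The hard-core event is measurable** (count σ-algebra). [cite: Richthammer2007, §4.4] -/
theorem measurableSet_hardCoreSet (σ : ℝ) : MeasurableSet (hardCoreSet σ : Set (PointConfig (𝔼 × 𝔼))) := by
  have h := measurableSet_hardCoreIn (d := d) σ MeasurableSet.univ
  have hset : {X : PointConfig (𝔼 × 𝔼) | HardCoreIn σ univ X} = hardCoreSet σ :=
    Set.ext fun _ => hardCoreIn_univ_iff
  rwa [hset] at h

/-! ### The reference Poisson law -/

open Classical in
/-- **The Poisson point process with intensity `ν`** on configurations of `ℝ^d × ℝ^d`: the unique law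
given by the tree's existence-and-uniqueness theorem (`existsUnique_isPoissonPointProcess_holds`)
when `ν` is locally finite and atomless, and the junk value `dirac ∅` otherwise.
[cite: Kingman1993, §2.5 Existence Theorem] -/
def poissonLaw (ν : Measure (𝔼 × 𝔼)) : Measure (PointConfig (𝔼 × 𝔼)) :=
  if h : IsLocallyFiniteMeasure ν ∧ ∀ x, ν {x} = 0 then
    Classical.choose (by haveI := h.1; exact (existsUnique_isPoissonPointProcess_holds (E := 𝔼 × 𝔼) ν h.2).exists)
  else Measure.dirac ∅

/-- `poissonLaw ν` is a Poisson point process with intensity `ν` whenever `ν` is locally finite and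
atomless. [cite: Kingman1993, §2.5 Existence Theorem] -/
theorem isPoissonPointProcess_poissonLaw (ν : Measure (𝔼 × 𝔼)) [hν : IsLocallyFiniteMeasure ν]
    (h0 : ∀ x, ν {x} = 0) : IsPoissonPointProcess ν (poissonLaw ν) := by
  have h : IsLocallyFiniteMeasure ν ∧ ∀ x, ν {x} = 0 := ⟨hν, h0⟩
  unfold poissonLaw
  rw [dif_pos h]
  exact Classical.choose_spec (by haveI := h.1; exact (existsUnique_isPoissonPointProcess_holds (E := 𝔼 × 𝔼) ν h.2).exists)

/-- The Poisson law of a restricted intensity. [cite: Kingman1993, §2.5] -/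
theorem isPoissonPointProcess_poissonLaw_restrict (ν : Measure (𝔼 × 𝔼)) [IsLocallyFiniteMeasure ν]
    (h0 : ∀ x, ν {x} = 0) (s : Set (𝔼 × 𝔼)) :
    IsPoissonPointProcess (ν.restrict s) (poissonLaw (ν.restrict s)) :=
  isPoissonPointProcess_poissonLaw _ fun x => nonpos_iff_eq_zero.mp ((Measure.restrict_apply_le _ _).trans_eq (h0 x))

/-- The Poisson law is a probability measure (in every case). [folklore] -/
instance isProbabilityMeasure_poissonLaw (ν : Measure (𝔼 × 𝔼)) : IsProbabilityMeasure (poissonLaw ν) := by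
  by_cases h : IsLocallyFiniteMeasure ν ∧ ∀ x, ν {x} = 0
  · haveI := h.1
    exact (isPoissonPointProcess_poissonLaw ν h.2).isProbabilityMeasure
  · unfold poissonLaw
    rw [dif_neg h]
    infer_instance

/-! ### Gluing -/

/-- **Gluing**: the configuration equal to `ξ` in the window of `Λ` and to the boundary condition
`η` outside it. [folklore] -/
def glue (Λ : Set 𝔼) (η ξ : PointConfig (𝔼 × 𝔼)) : PointConfig (𝔼 × 𝔼) :=
  ξ.restrict (window Λ) ∪ η.restrict (window Λ)ᶜ

omit [Fintype d] in
/-- Membership in a glued configuration. [folklore] -/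
theorem mem_glue_iff {Λ : Set 𝔼} {η ξ : PointConfig (𝔼 × 𝔼)} {x : 𝔼 × 𝔼} :
    x ∈ glue Λ η ξ ↔ (x ∈ ξ ∧ x.1 ∈ Λ) ∨ (x ∈ η ∧ x.1 ∉ Λ) := by
  change (x ∈ ξ.carrier ∩ window Λ ∨ x ∈ η.carrier ∩ (window Λ)ᶜ) ↔ _
  simp [mem_window]

/-- Gluing is measurable in the inner configuration. [folklore] -/
theorem measurable_glue {Λ : Set 𝔼} (hΛ : MeasurableSet Λ) (η : PointConfig (𝔼 × 𝔼)) :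
    Measurable (glue Λ η) := by
  have hu : Measurable fun p : PointConfig (𝔼 × 𝔼) × PointConfig (𝔼 × 𝔼) => p.1 ∪ p.2 :=
    PointConfig.measurable_union'
  have hpair : Measurable fun ξ : PointConfig (𝔼 × 𝔼) => (ξ.restrict (window Λ), η.restrict (window Λ)ᶜ) :=
    (PointConfig.measurable_restrict (measurableSet_window hΛ)).prodMk measurable_const
  exact hu.comp hpair

/-- Gluing is jointly measurable in the boundary condition and the inner configuration. [folklore] -/
theorem measurable_glue_uncurry {Λ : Set 𝔼} (hΛ : MeasurableSet Λ) :
    Measurable fun q : PointConfig (𝔼 × 𝔼) × PointConfig (𝔼 × 𝔼) => glue Λ q.1 q.2 := by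
  have hu : Measurable fun c : PointConfig (𝔼 × 𝔼) × PointConfig (𝔼 × 𝔼) => c.1 ∪ c.2 :=
    PointConfig.measurable_union'
  exact hu.comp (((PointConfig.measurable_restrict (measurableSet_window hΛ)).comp measurable_snd).prodMk
    ((PointConfig.measurable_restrict (measurableSet_window hΛ).compl).comp measurable_fst))

omit [Fintype d] in
/-- Membership in a restricted configuration. [folklore] -/
theorem mem_restrict_iff {s : Set (𝔼 × 𝔼)} {c : PointConfig (𝔼 × 𝔼)} {x : 𝔼 × 𝔼} :
    x ∈ c.restrict s ↔ x ∈ c ∧ x ∈ s := Iff.rfl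

omit [Fintype d] in
/-- Superposition with the empty configuration on the left. [folklore] -/
@[simp] theorem empty_union' (c : PointConfig (𝔼 × 𝔼)) : (∅ : PointConfig (𝔼 × 𝔼)) ∪ c = c :=
  PointConfig.ext fun x => by
    simp only [PointConfig.mem_union, or_iff_right_iff_imp]
    exact fun hx => absurd (show x ∈ (∅ : PointConfig (𝔼 × 𝔼)).carrier from hx) (by simp)

omit [Fintype d] in
/-- The empty configuration restricts to itself. [folklore] -/
@[simp] theorem restrict_empty' (s : Set (𝔼 × 𝔼)) : (∅ : PointConfig (𝔼 × 𝔼)).restrict s = ∅ :=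
  PointConfig.ext fun x => by
    simp only [mem_restrict_iff]
    constructor
    · exact fun hx => hx.1
    · exact fun hx => absurd (show x ∈ (∅ : PointConfig (𝔼 × 𝔼)).carrier from hx) (by simp)

omit [Fintype d] in
/-- Restriction distributes over superposition. [folklore] -/
theorem restrict_union' (s : Set (𝔼 × 𝔼)) (c e : PointConfig (𝔼 × 𝔼)) :
    (c ∪ e).restrict s = c.restrict s ∪ e.restrict s :=
  PointConfig.ext fun x => by
    simp only [mem_restrict_iff, PointConfig.mem_union]
    tauto

omit [Fintype d] in
/-- Restricting twice to nested windows. [folklore] -/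
theorem restrict_restrict_of_subset {s t : Set (𝔼 × 𝔼)} (h : s ⊆ t) (c : PointConfig (𝔼 × 𝔼)) :
    (c.restrict t).restrict s = c.restrict s :=
  PointConfig.ext fun x => by
    simp only [mem_restrict_iff]
    exact ⟨fun hx => ⟨hx.1.1, hx.2⟩, fun hx => ⟨⟨hx.1, h hx.2⟩, hx.2⟩⟩

omit [Fintype d] in
/-- Gluing to the empty boundary condition is restriction to the window. [folklore] -/
theorem glue_empty (Λ : Set 𝔼) (ξ : PointConfig (𝔼 × 𝔼)) : glue Λ ∅ ξ = ξ.restrict (window Λ) := by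
  rw [glue, restrict_empty']
  exact PointConfig.ext fun x => by
    simp only [PointConfig.mem_union, or_iff_left_iff_imp]
    exact fun hx => absurd (show x ∈ (∅ : PointConfig (𝔼 × 𝔼)).carrier from hx) (by simp)

omit [Fintype d] in
/-- Outside the window of `Λ` a glued configuration is the boundary condition. [folklore] -/
theorem restrict_compl_glue (Λ : Set 𝔼) (η ξ : PointConfig (𝔼 × 𝔼)) :
    (glue Λ η ξ).restrict (window Λ)ᶜ = η.restrict (window Λ)ᶜ := by
  refine PointConfig.ext fun x => ?_
  simp only [glue, mem_restrict_iff, PointConfig.mem_union, mem_compl_iff]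
  tauto

omit [Fintype d] in
/-- Inside the window of `Λ` a glued configuration is the inner configuration. [folklore] -/
theorem restrict_glue (Λ : Set 𝔼) (η ξ : PointConfig (𝔼 × 𝔼)) :
    (glue Λ η ξ).restrict (window Λ) = ξ.restrict (window Λ) := by
  refine PointConfig.ext fun x => ?_
  simp only [glue, mem_restrict_iff, PointConfig.mem_union, mem_compl_iff]
  tauto

omit [Fintype d] in
/-- Gluing only sees the boundary condition outside the window. [folklore] -/
theorem glue_congr_boundary {Λ : Set 𝔼} {η η' : PointConfig (𝔼 × 𝔼)}
    (h : η.restrict (window Λ)ᶜ = η'.restrict (window Λ)ᶜ) (ξ : PointConfig (𝔼 × 𝔼)) :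
    glue Λ η ξ = glue Λ η' ξ := by
  rw [glue, glue, h]

omit [Fintype d] in
/-- Gluing only sees the inner configuration inside the window. [folklore] -/
theorem glue_restrict_window (Λ : Set 𝔼) (η ξ : PointConfig (𝔼 × 𝔼)) :
    glue Λ η (ξ.restrict (window Λ)) = glue Λ η ξ := by
  rw [glue, glue, restrict_restrict_of_subset subset_rfl]

/-! ### The finite-volume Gibbs distribution and its DLR states -/

/-- **The finite-volume local Gibbs distribution of hard spheres** of diameter `σ` in the region `Λ`
with boundary condition `η`, for a one-particle intensity `ν` on `ℝ^d × ℝ^d`: a Poisson configuration of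
intensity `ν|_{Λ × ℝ^d}` glued to `η` outside `Λ` and conditioned on the hard core of the glued
configuration.  Junk: `0` if the hard-core event is null. [cite: Georgii2011, Def. 1.23] -/
def hsLocalSpec (σ : ℝ) (ν : Measure (𝔼 × 𝔼)) (Λ : Set 𝔼) (η : PointConfig (𝔼 × 𝔼)) :
    Measure (PointConfig (𝔼 × 𝔼)) :=
  let W := ((poissonLaw (ν.restrict (window Λ))).map (glue Λ η)).restrict (hardCoreSet σ)
  (W univ)⁻¹ • W

/-- Unfolding lemma for `hsLocalSpec`. [folklore] -/
theorem hsLocalSpec_def (σ : ℝ) (ν : Measure (𝔼 × 𝔼)) (Λ : Set 𝔼) (η : PointConfig (𝔼 × 𝔼)) :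
    hsLocalSpec σ ν Λ η =
      ((((poissonLaw (ν.restrict (window Λ))).map (glue Λ η)).restrict (hardCoreSet σ)) univ)⁻¹ •
        ((poissonLaw (ν.restrict (window Λ))).map (glue Λ η)).restrict (hardCoreSet σ) :=
  rfl

/-- The local Gibbs distribution is supported on hard-core configurations. [folklore] -/
theorem hsLocalSpec_apply_compl_hardCoreSet (σ : ℝ) (ν : Measure (𝔼 × 𝔼)) (Λ : Set 𝔼)
    (η : PointConfig (𝔼 × 𝔼)) : hsLocalSpec σ ν Λ η (hardCoreSet σ)ᶜ = 0 := by
  rw [hsLocalSpec_def, Measure.smul_apply, smul_eq_mul,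
    Measure.restrict_apply (measurableSet_hardCoreSet _).compl, compl_inter_self,
    measure_empty, mul_zero]

/-- The local Gibbs distribution has total mass `≤ 1`. [folklore] -/
theorem hsLocalSpec_apply_univ_le_one (σ : ℝ) (ν : Measure (𝔼 × 𝔼)) (Λ : Set 𝔼)
    (η : PointConfig (𝔼 × 𝔼)) : hsLocalSpec σ ν Λ η univ ≤ 1 := by
  rw [hsLocalSpec_def, Measure.smul_apply, smul_eq_mul]
  exact ENNReal.inv_mul_le_one _

/-- Every event has probability `≤ 1` under the local Gibbs distribution. [folklore] -/
theorem hsLocalSpec_apply_le_one (σ : ℝ) (ν : Measure (𝔼 × 𝔼)) (Λ : Set 𝔼) (η : PointConfig (𝔼 × 𝔼))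
    (A : Set (PointConfig (𝔼 × 𝔼))) : hsLocalSpec σ ν Λ η A ≤ 1 :=
  (measure_mono (subset_univ A)).trans (hsLocalSpec_apply_univ_le_one σ ν Λ η)

/-- The local Gibbs distribution is a finite measure. [folklore] -/
instance isFiniteMeasure_hsLocalSpec (σ : ℝ) (ν : Measure (𝔼 × 𝔼)) (Λ : Set 𝔼) (η : PointConfig (𝔼 × 𝔼)) :
    IsFiniteMeasure (hsLocalSpec σ ν Λ η) :=
  ⟨lt_of_le_of_lt (hsLocalSpec_apply_univ_le_one σ ν Λ η) ENNReal.one_lt_top⟩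

/-- The local Gibbs distribution is carried by hard-core configurations. [folklore] -/
theorem hsLocalSpec_ae_isHardCore (σ : ℝ) (ν : Measure (𝔼 × 𝔼)) (Λ : Set 𝔼) (η : PointConfig (𝔼 × 𝔼)) :
    ∀ᵐ ζ ∂(hsLocalSpec σ ν Λ η), IsHardCore σ ζ := by
  rw [ae_iff]
  exact hsLocalSpec_apply_compl_hardCoreSet σ ν Λ η

/-- **The specification in terms of the reference law**: for measurable `A`,
`γ_Λ(A | η) = P_Λ{glue ∈ hard core}⁻¹ · P_Λ{glue ∈ A ∩ hard core}`. [folklore] -/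
theorem hsLocalSpec_apply_eq (σ : ℝ) (ν : Measure (𝔼 × 𝔼)) {Λ : Set 𝔼} (hΛ : MeasurableSet Λ)
    (η : PointConfig (𝔼 × 𝔼)) {A : Set (PointConfig (𝔼 × 𝔼))} (hA : MeasurableSet A) :
    hsLocalSpec σ ν Λ η A =
      (poissonLaw (ν.restrict (window Λ)) (glue Λ η ⁻¹' hardCoreSet σ))⁻¹ *
        poissonLaw (ν.restrict (window Λ)) (glue Λ η ⁻¹' (A ∩ hardCoreSet σ)) := by
  have hH := measurableSet_hardCoreSet (d := d) σ
  have hg := measurable_glue hΛ η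
  rw [hsLocalSpec_def, Measure.smul_apply, smul_eq_mul, Measure.restrict_apply hA,
    Measure.restrict_apply MeasurableSet.univ, univ_inter, Measure.map_apply hg (hA.inter hH),
    Measure.map_apply hg hH]

/-- The local Gibbs distribution only depends on the boundary condition outside the window.
[cite: Georgii2011, Def. 1.23] -/
theorem hsLocalSpec_congr_boundary (σ : ℝ) (ν : Measure (𝔼 × 𝔼)) (Λ : Set 𝔼) {η η' : PointConfig (𝔼 × 𝔼)}
    (h : η.restrict (window Λ)ᶜ = η'.restrict (window Λ)ᶜ) : hsLocalSpec σ ν Λ η = hsLocalSpec σ ν Λ η' := by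
  have hg : glue Λ η = glue Λ η' := funext (glue_congr_boundary h)
  rw [hsLocalSpec_def, hsLocalSpec_def, hg]

/-- **Local Gibbs (DLR) state of the hard-sphere gas** of diameter `σ` with one-particle intensity `ν`:
a probability measure whose conditional law in every bounded Borel region, given the outside, is
`hsLocalSpec σ ν Λ`: `∫ γ_Λ(η)(A) dμ(η) = μ(A)`. [cite: Georgii2011, Def. 1.23] -/
def IsHsLocalGibbs (σ : ℝ) (ν : Measure (𝔼 × 𝔼)) (μ : Measure (PointConfig (𝔼 × 𝔼))) : Prop :=
  IsProbabilityMeasure μ ∧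
    ∀ Λ : Set 𝔼, MeasurableSet Λ → Bornology.IsBounded Λ →
      ∀ A : Set (PointConfig (𝔼 × 𝔼)), MeasurableSet A → ∫⁻ η, hsLocalSpec σ ν Λ η A ∂μ = μ A

namespace IsHsLocalGibbs

variable {σ : ℝ}

/-- A local Gibbs state is a probability measure. [folklore] -/
theorem isProbabilityMeasure {ν : Measure (𝔼 × 𝔼)} {μ : Measure (PointConfig (𝔼 × 𝔼))}
    (h : IsHsLocalGibbs σ ν μ) : IsProbabilityMeasure μ := h.1

/-- The DLR equation of a local Gibbs state. [cite: Georgii2011, Def. 1.23] -/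
theorem lintegral_hsLocalSpec {ν : Measure (𝔼 × 𝔼)} {μ : Measure (PointConfig (𝔼 × 𝔼))}
    (h : IsHsLocalGibbs σ ν μ) {Λ : Set 𝔼} (hΛ : MeasurableSet Λ)
    (hb : Bornology.IsBounded Λ) {A : Set (PointConfig (𝔼 × 𝔼))} (hA : MeasurableSet A) :
    ∫⁻ η, hsLocalSpec σ ν Λ η A ∂μ = μ A :=
  h.2 Λ hΛ hb A hA

/-- **A local Gibbs state is carried by hard-core configurations**: `μ {hard core}ᶜ = 0`. [folklore] -/
theorem measure_compl_hardCoreSet {ν : Measure (𝔼 × 𝔼)} {μ : Measure (PointConfig (𝔼 × 𝔼))}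
    (h : IsHsLocalGibbs σ ν μ) : μ (hardCoreSet σ : Set (PointConfig (𝔼 × 𝔼)))ᶜ = 0 := by
  rw [← h.lintegral_hsLocalSpec MeasurableSet.empty Bornology.isBounded_empty
    (measurableSet_hardCoreSet σ).compl]
  simp [hsLocalSpec_apply_compl_hardCoreSet]

/-- Almost every configuration of a local Gibbs state satisfies the hard-core constraint. [folklore] -/
theorem ae_isHardCore {ν : Measure (𝔼 × 𝔼)} {μ : Measure (PointConfig (𝔼 × 𝔼))}
    (h : IsHsLocalGibbs σ ν μ) : ∀ᵐ c ∂μ, IsHardCore σ (c : PointConfig (𝔼 × 𝔼)) := by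
  rw [ae_iff]
  exact h.measure_compl_hardCoreSet

end IsHsLocalGibbs

end HardSphereDLR

end Literature.MathematicalPhysics.KineticTheory
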